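import Literature.NumberTheory.Transcendental.NesterenkoGenericSection
import Literature.NumberTheory.Transcendental.NesterenkoChowFormDistinct
import Mathlib.RingTheory.Localization.FractionRing
import Mathlib.FieldTheory.IntermediateField.Adjoin.Basic
import HarnessLib

/-!
# Towards LNM 1752 Ch. 3 Proposition 4.11, V: the field of the generic linear section

`Literature/NumberTheory/Transcendental/NesterenkoGenericSectionField.lean`. Fifth step of the
discharge of the named fact `NesterenkoPhilippon2001_ch3_prop_4_11` (Nesterenko–Philippon (eds.),
LNM 1752 (2001), Ch. 3 Prop. 4.11 = [Nes10, Prop. 1.4]); sequel of `NesterenkoGenericSection.lean`.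

For a homogeneous prime `𝔭 ⊂ ℚ[x₀, …, x_m]` of rank `s + 1` (`dim V(𝔭) = s`) and a chart
`x_j ∉ 𝔭` we realise the GENERIC POINT of the section of `V(𝔭)` by the `s` generic hyperplanes
`L₁ = … = L_s = 0` inside the field `𝕃 = Frac(ℚ(𝔭)[U'])`, `ℚ(𝔭) = Frac(ℚ[x̲]/𝔭)`, using the
pivot homomorphism `Φⱼ` of `NesterenkoElimIdealPrime.lean` (`xₖ ↦ x̄ₖ`, `u_{ik} ↦ u_{ik}` for
`k ≠ j`, `u_{ij} ↦ −(∑_{k≠j} u_{ik} x̄ₖ)/x̄ⱼ`, so that `Lᵢ ↦ 0`):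

* `GSec m` bundles the data `(𝔭, s, j)` with the hypotheses (prime, homogeneous, `x_j ∉ 𝔭`,
  `dim ℚ[x̲]/𝔭 = s + 1`); `𝒢.LL = 𝕃`, `𝒢.Kp = K' = ℚ(U')`;
* `𝒢.toRUL : ℚ[U'] → ℚ(𝔭)[U']` (`Φⱼ` on the first `s` groups) is INJECTIVE (`toRUL_injective`:
  its kernel is `Ī(s) = 0` by `mem_elimIdeal_iff_pivotMap_eq_zero` and `elimIdeal_eq_bot_of_lt`),
  so `𝕃` is an extension of `K'` (`FractionRing.liftAlgebra`);
* the section point `ρ = (x̄ₖ/x̄ⱼ)ₖ ∈ 𝕃^{m+1}` (`𝒢.rho`, `ρⱼ = 1`) is a zero of `𝔭` on the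
  hyperplanes `L₁(u'), …, L_s(u')` (`aeval_rho_eq_zero`, `sum_algebraMap_X_mul_rho`), and for
  `F ∈ Ī(s+1)` (the associated form of `𝔭` in `s + 1` groups) the specialised polynomial
  `P_l(t) = F(u₁, …, u_s; t e_j + e_l) ∈ ℚ[U'][t]` of `NesterenkoGenericSection.lean` has the ROOT
  `−ρ_{j.succAbove l}` (`genEval_rename_inl_eq_zero`, `aeval_specLast_neg_rho`: the substitution
  `x ↦ x̄`, `u' ↦ Φⱼ(u')`, `u_{s+1} ↦ −ρ_l e_j + e_l` kills `(𝔭, L₁, …, L_{s+1}) ∋ F x_j^M`);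
* hence every `ρₖ` is algebraic over `K'` (`isAlgebraic_rho`, as `P_l ≠ 0` by
  `specLast_chowForm_ne_zero`) and the field of the generic section
  `𝕃₀ = K'(ρ₀, …, ρ_m)` (`𝒢.L0`) is a FINITE extension of `K'` (`finiteDimensional_L0`) — the field
  in which the norm form of Prop. 4.11 is a norm.

Definitions here are plumbing with bodies (`GSec`, its abbreviations, `toRUL`, `toLL`, `rho`,
`lastValL`, `genUVal`, `genEval`, `L0`); no named facts.

## References

* [NesterenkoPhilippon2001] LNM 1752 (2001), Ch. 3 §4, Def. 4.3, Prop. 4.4 (p. 38), Prop. 4.11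
  (pp. 40–41).
* [Nes10] Yu. V. Nesterenko, Proc. Steklov Inst. Math. 218 (1997) 294–331, §1.
* [HodgePedoe1994] W. V. D. Hodge, D. Pedoe, *Methods of Algebraic Geometry* II, Ch. X §§6–7
  (generic points and the Cayley form).
-/

noncomputable section

open MvPolynomial

attribute [local instance] MvPolynomial.gradedAlgebra

namespace Literature.NumberTheory.Transcendental

namespace Nesterenko

variable {m : ℕ}

/-! ### The data of a generic section -/

/-- A homogeneous prime `𝔭 ⊂ ℚ[x₀, …, x_m]` of rank `s + 1` with a chart `x_j ∉ 𝔭`.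
[cite: NesterenkoPhilippon2001, Ch. 3 Prop. 4.11 (pp. 40–41)] -/
structure GSec (m : ℕ) where
  /-- the prime ideal -/
  𝔭 : Ideal (Rx m)
  /-- the number of generic hyperplanes, `dim V(𝔭)` -/
  s : ℕ
  /-- the chart -/
  j : Fin (m + 1)
  prime : 𝔭.IsPrime
  hom : 𝔭.IsHomogeneous (homogeneousSubmodule (Fin (m + 1)) ℚ)
  chart : (X j : Rx m) ∉ 𝔭
  rank : ringKrullDim (Rx m ⧸ 𝔭) = (s + 1 : ℕ)

namespace GSec

variable (𝒢 : GSec m)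

/-- `𝔭` is prime (instance form). [folklore] -/
instance isPrime : 𝒢.𝔭.IsPrime := 𝒢.prime

/-- `ℚ(𝔭) = Frac(ℚ[x̲]/𝔭)`, the function field of the cone. [folklore] -/
abbrev Lp : Type := FractionRing (Rx m ⧸ 𝒢.𝔭)

/-- `ℚ(𝔭)[U']` (`s` groups of variables). [folklore] -/
abbrev RUL : Type := MvPolynomial (Fin 𝒢.s × Fin (m + 1)) 𝒢.Lp

/-- `𝕃 = Frac(ℚ(𝔭)[U'])`. [folklore] -/
abbrev LL : Type := FractionRing 𝒢.RUL

/-- `K' = ℚ(U')`. [folklore] -/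
abbrev Kp : Type := FractionRing (RU 𝒢.s m)

/-- `Φⱼ` restricted to `ℚ[U']`: `ℚ[U'] → ℚ(𝔭)[U']`. [folklore] -/
def toRUL : RU 𝒢.s m →ₐ[ℚ] 𝒢.RUL :=
  (NesterenkoK.pivotMap 𝒢.𝔭 𝒢.s 𝒢.j).comp (rename Sum.inl)

/-- `toRUL` unfolded. [folklore] -/
theorem toRUL_apply (G : RU 𝒢.s m) :
    𝒢.toRUL G = NesterenkoK.pivotMap 𝒢.𝔭 𝒢.s 𝒢.j (rename Sum.inl G) := rfl

/-- `toRUL` on a variable. [folklore] -/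
theorem toRUL_X (v : Fin 𝒢.s × Fin (m + 1)) :
    𝒢.toRUL (X v) = NesterenkoK.pivotMap 𝒢.𝔭 𝒢.s 𝒢.j (X (Sum.inl v)) := by
  rw [toRUL_apply, rename_X]

/-- **`ℚ[U'] → ℚ(𝔭)[U']` is injective**: its kernel is `Ī(s) = 0` (`s < s + 1 = rank`).
[cite: NesterenkoPhilippon2001, Ch. 3 Prop. 4.4 (p. 38)] -/
theorem toRUL_injective : Function.Injective 𝒢.toRUL := by
  rw [injective_iff_map_eq_zero]
  intro G hG
  rw [toRUL_apply, ← NesterenkoK.mem_elimIdeal_iff_pivotMap_eq_zero 𝒢.𝔭 𝒢.chart,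
    ← elimIdeal_eq, elimIdeal_eq_bot_of_lt 𝒢.prime 𝒢.hom 𝒢.rank (Nat.lt_succ_self _)] at hG
  exact hG

/-- `ℚ[U'] → 𝕃`. [folklore] -/
def toLL : RU 𝒢.s m →ₐ[ℚ] 𝒢.LL :=
  (IsScalarTower.toAlgHom ℚ 𝒢.RUL 𝒢.LL).comp 𝒢.toRUL

/-- `toLL` unfolded. [folklore] -/
theorem toLL_apply (G : RU 𝒢.s m) : 𝒢.toLL G = algebraMap 𝒢.RUL 𝒢.LL (𝒢.toRUL G) := rfl

/-- `ℚ[U'] → 𝕃` is injective. [folklore] -/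
theorem toLL_injective : Function.Injective 𝒢.toLL :=
  (IsFractionRing.injective 𝒢.RUL 𝒢.LL).comp 𝒢.toRUL_injective

/-- `𝕃` as an algebra over `A = ℚ[U']`. [folklore] -/
instance algebraA : Algebra (RU 𝒢.s m) 𝒢.LL := 𝒢.toLL.toRingHom.toAlgebra

/-- Short-cut instance (the generic search through the localisation instances times out).
[folklore] -/
instance smulA : SMul (RU 𝒢.s m) 𝒢.LL := Algebra.toSMul

/-- Short-cut instance. [folklore] -/
instance moduleA : Module (RU 𝒢.s m) 𝒢.LL := Algebra.toModule

/-- The structure map `A → 𝕃` unfolded. [folklore] -/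
theorem algebraMap_A_apply (G : RU 𝒢.s m) :
    algebraMap (RU 𝒢.s m) 𝒢.LL G = algebraMap 𝒢.RUL 𝒢.LL (𝒢.toRUL G) := rfl

/-- `A → 𝕃` is injective (instance form). [folklore] -/
instance faithfulSMulA : FaithfulSMul (RU 𝒢.s m) 𝒢.LL :=
  (faithfulSMul_iff_algebraMap_injective _ _).mpr 𝒢.toLL_injective

/-- `𝕃` as an extension of `K' = ℚ(U')`. [folklore] -/
instance algebraKp : Algebra 𝒢.Kp 𝒢.LL := FractionRing.liftAlgebra (RU 𝒢.s m) 𝒢.LL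

/-- Short-cut instance. [folklore] -/
instance smulKp : SMul 𝒢.Kp 𝒢.LL := Algebra.toSMul

/-- Short-cut instance. [folklore] -/
instance moduleKp : Module 𝒢.Kp 𝒢.LL := Algebra.toModule

/-- The tower `A → K' → 𝕃`. [folklore] -/
instance towerAKp : IsScalarTower (RU 𝒢.s m) 𝒢.Kp 𝒢.LL :=
  FractionRing.isScalarTower_liftAlgebra (RU 𝒢.s m) 𝒢.LL

/-! ### The generic section point `ρ` -/

/-- `x̄ₖ ∈ ℚ(𝔭)`. [folklore] -/
abbrev xb (k : Fin (m + 1)) : 𝒢.Lp := NesterenkoK.xbar 𝒢.𝔭 k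

/-- `x̄ⱼ ≠ 0`. [folklore] -/
theorem xb_j_ne_zero : 𝒢.xb 𝒢.j ≠ 0 := NesterenkoK.xbar_ne_zero 𝒢.𝔭 𝒢.chart

/-- The generic point `ξ = (x̄ₖ)` of the cone, in `𝕃`. [folklore] -/
def xi (k : Fin (m + 1)) : 𝒢.LL := algebraMap 𝒢.Lp 𝒢.LL (𝒢.xb k)

/-- The generic section point `ρ = (x̄ₖ / x̄ⱼ)ₖ ∈ 𝕃^{m+1}` (`ρⱼ = 1`).
[cite: NesterenkoPhilippon2001, Ch. 3 Prop. 4.11 (pp. 40–41)] -/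
def rho (k : Fin (m + 1)) : 𝒢.LL := algebraMap 𝒢.Lp 𝒢.LL ((𝒢.xb 𝒢.j)⁻¹ * 𝒢.xb k)

/-- `ρ = x̄ⱼ⁻¹ ξ`. [folklore] -/
theorem rho_eq_smul_xi : 𝒢.rho = algebraMap 𝒢.Lp 𝒢.LL (𝒢.xb 𝒢.j)⁻¹ • 𝒢.xi := by
  funext k
  simp [rho, xi, map_mul]

/-- `ρⱼ = 1`. [folklore] -/
theorem rho_j : 𝒢.rho 𝒢.j = 1 := by
  rw [rho, inv_mul_cancel₀ 𝒢.xb_j_ne_zero, map_one]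

/-- `ρ ≠ 0`. [folklore] -/
theorem rho_ne_zero : 𝒢.rho ≠ 0 := fun h => by
  have := congrFun h 𝒢.j
  rw [rho_j] at this
  exact one_ne_zero this

/-- `ℚ(𝔭) → 𝕃` through the constants of `ℚ(𝔭)[U']`. [folklore] -/
theorem algebraMap_Lp_eq (x : 𝒢.Lp) : algebraMap 𝒢.Lp 𝒢.LL x = algebraMap 𝒢.RUL 𝒢.LL (C x) := by
  rw [IsScalarTower.algebraMap_apply 𝒢.Lp 𝒢.RUL 𝒢.LL, MvPolynomial.algebraMap_eq]

/-- `ξ` is a zero of exactly `𝔭` (generic point). [folklore] -/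
theorem aeval_xi_eq_zero_iff (P : Rx m) : aeval 𝒢.xi P = 0 ↔ P ∈ 𝒢.𝔭 := by
  have hφ : Function.Injective (IsScalarTower.toAlgHom ℚ 𝒢.RUL 𝒢.LL) :=
    IsFractionRing.injective 𝒢.RUL 𝒢.LL
  have h := NesterenkoK.aeval_xbar_eq_zero_iff 𝒢.𝔭 (IsScalarTower.toAlgHom ℚ 𝒢.RUL 𝒢.LL) hφ P
  have hfun : (fun k => (IsScalarTower.toAlgHom ℚ 𝒢.RUL 𝒢.LL) (C (NesterenkoK.xbar 𝒢.𝔭 k))) = 𝒢.xi := by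
    funext k
    rw [IsScalarTower.coe_toAlgHom', xi, algebraMap_Lp_eq]
  rwa [hfun] at h

/-- **`ρ` is a zero of `𝔭`** (`𝔭` is homogeneous and `ρ = x̄ⱼ⁻¹ ξ`).
[cite: NesterenkoPhilippon2001, Ch. 3 Prop. 4.11 (pp. 40–41)] -/
theorem aeval_rho_eq_zero {P : Rx m} (hP : P ∈ 𝒢.𝔭) : aeval 𝒢.rho P = 0 := by
  rw [rho_eq_smul_xi]
  exact NesterenkoK.aeval_smul_eq_zero_of_forall 𝒢.hom
    (fun Q hQ => (𝒢.aeval_xi_eq_zero_iff Q).mpr hQ) _ P hP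

/-- **`ρ` lies on the generic hyperplanes**: `∑ₖ u_{ik} ρₖ = 0` in `𝕃` (`Φⱼ(Lᵢ) = 0`).
[cite: NesterenkoPhilippon2001, Ch. 3 Prop. 4.11 (pp. 40–41)] -/
theorem sum_algebraMap_X_mul_rho (i : Fin 𝒢.s) :
    ∑ k : Fin (m + 1), algebraMap (RU 𝒢.s m) 𝒢.LL (X (i, k)) * 𝒢.rho k = 0 := by
  have h0 := NesterenkoK.pivotMap_linForm 𝒢.𝔭 (r := 𝒢.s) 𝒢.chart i
  rw [NesterenkoK.linForm, map_sum] at h0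
  have h1 : ∑ k : Fin (m + 1), algebraMap (RU 𝒢.s m) 𝒢.LL (X (i, k)) * 𝒢.xi k = 0 := by
    have : ∀ k, algebraMap (RU 𝒢.s m) 𝒢.LL (X (i, k)) * 𝒢.xi k = algebraMap 𝒢.RUL 𝒢.LL
        (NesterenkoK.pivotMap 𝒢.𝔭 𝒢.s 𝒢.j (X (Sum.inl (i, k)) * X (Sum.inr k))) := fun k => by
      rw [algebraMap_A_apply, toRUL_X, xi, algebraMap_Lp_eq, ← map_mul,
        map_mul (NesterenkoK.pivotMap _ _ _), NesterenkoK.pivotMap_X_inr]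
    simp_rw [this]
    rw [← map_sum, h0, map_zero]
  rw [rho_eq_smul_xi]
  simp only [Pi.smul_apply, smul_eq_mul]
  calc ∑ k, algebraMap (RU 𝒢.s m) 𝒢.LL (X (i, k)) * (algebraMap 𝒢.Lp 𝒢.LL (𝒢.xb 𝒢.j)⁻¹ * 𝒢.xi k)
        = algebraMap 𝒢.Lp 𝒢.LL (𝒢.xb 𝒢.j)⁻¹ *
          ∑ k, algebraMap (RU 𝒢.s m) 𝒢.LL (X (i, k)) * 𝒢.xi k := by
          rw [Finset.mul_sum]; exact Finset.sum_congr rfl fun k _ => by ring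
    _ = 0 := by rw [h1, mul_zero]

/-! ### The root relation `P_l(−ρ_{j.succAbove l}) = 0` -/

section Root

variable (l : Fin m)

/-- The values `−x̄_{j.succAbove l} x̄ⱼ⁻¹ e_j + e_l` of the last group (in `ℚ(𝔭)[U']`). [folklore] -/
def lastValL : Fin (m + 1) → 𝒢.RUL :=
  lastVal 𝒢.j l (C (-((𝒢.xb 𝒢.j)⁻¹ * 𝒢.xb (𝒢.j.succAbove l))))

/-- The values of the `u_{ik}`: `Φⱼ` on the first `s` groups, `lastValL` on the last. [folklore] -/
def genUVal (v : Fin (𝒢.s + 1) × Fin (m + 1)) : 𝒢.RUL :=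
  Fin.lastCases (motive := fun _ => 𝒢.RUL) (𝒢.lastValL l v.2)
    (fun i => NesterenkoK.pivotFamily 𝒢.𝔭 𝒢.s 𝒢.j (Sum.inl (i, v.2))) v.1

/-- **`Ψ_l : ℚ[u₁, …, u_{s+1}, x̲] → ℚ(𝔭)[U']`**: `x ↦ x̄`, `u' ↦ Φⱼ(u')`,
`u_{s+1} ↦ −ρ_l e_j + e_l`. [folklore] -/
def genEval : RUX (𝒢.s + 1) m →ₐ[ℚ] 𝒢.RUL :=
  aeval (Sum.elim (𝒢.genUVal l) fun k => C (𝒢.xb k))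

/-- `Ψ_l(xₖ) = x̄ₖ`. [folklore] -/
theorem genEval_X_inr (k : Fin (m + 1)) : 𝒢.genEval l (X (Sum.inr k)) = C (𝒢.xb k) := by
  simp [genEval]

/-- `Ψ_l` on the `u`-variables. [folklore] -/
theorem genEval_X_inl (v : Fin (𝒢.s + 1) × Fin (m + 1)) :
    𝒢.genEval l (X (Sum.inl v)) = 𝒢.genUVal l v := by
  simp [genEval]

/-- `Ψ_l` on `ℚ[x̲]` is reduction modulo `𝔭` followed by the constants. [folklore] -/
theorem genEval_rename_inr (P : Rx m) :
    𝒢.genEval l (rename Sum.inr P) = C (algebraMap (Rx m) 𝒢.Lp P) := by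
  have hcomp : (𝒢.genEval l).comp (rename Sum.inr) =
      (IsScalarTower.toAlgHom ℚ 𝒢.Lp 𝒢.RUL).comp (IsScalarTower.toAlgHom ℚ (Rx m) 𝒢.Lp) := by
    refine MvPolynomial.algHom_ext fun k => ?_
    simp [genEval, NesterenkoK.xbar]
  have := congrArg (fun f => f P) hcomp
  simpa using this

/-- `Ψ_l` restricted to the first `s` groups is `Φⱼ`. [folklore] -/
theorem genEval_comp_liftUX :
    (𝒢.genEval l).comp (liftUX 𝒢.s) = NesterenkoK.pivotMap 𝒢.𝔭 𝒢.s 𝒢.j := by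
  refine MvPolynomial.algHom_ext fun v => ?_
  rcases v with ⟨i, k⟩ | k
  · rw [AlgHom.comp_apply, liftUX, rename_X, Sum.map_inl, genEval_X_inl, genUVal,
      Fin.lastCases_castSucc, NesterenkoK.pivotMap, aeval_X]
  · rw [AlgHom.comp_apply, liftUX, rename_X, Sum.map_inr, id, genEval_X_inr,
      NesterenkoK.pivotMap_X_inr]

/-- `Ψ_l` kills `Lᵢ`, `i ≤ s`. [folklore] -/
theorem genEval_linForm_castSucc (i : Fin 𝒢.s) :
    𝒢.genEval l (linForm (𝒢.s + 1) m (Fin.castSucc i)) = 0 := by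
  rw [linForm_castSucc, ← AlgHom.comp_apply, genEval_comp_liftUX, linForm_eq]
  exact NesterenkoK.pivotMap_linForm 𝒢.𝔭 𝒢.chart i

/-- `Ψ_l` kills `L_{s+1}`: `−x̄_l x̄ⱼ⁻¹ · x̄ⱼ + x̄_l = 0`. [folklore] -/
theorem genEval_linForm_last : 𝒢.genEval l (linForm (𝒢.s + 1) m (Fin.last 𝒢.s)) = 0 := by
  have hu : ∀ k, 𝒢.genEval l (X (Sum.inl (Fin.last 𝒢.s, k))) = 𝒢.lastValL l k := fun k => by
    rw [genEval_X_inl, genUVal, Fin.lastCases_last]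
  simp only [linForm, map_sum, map_mul, hu, genEval_X_inr]
  rw [Fin.sum_univ_succAbove _ 𝒢.j, lastValL, lastVal_same]
  simp only [lastVal_succAbove]
  rw [Finset.sum_eq_single l (fun k _ hk => by rw [if_neg hk, zero_mul])
    (fun h => absurd (Finset.mem_univ l) h), if_pos rfl, one_mul, ← map_mul, ← map_add,
    neg_mul, mul_right_comm, inv_mul_cancel₀ 𝒢.xb_j_ne_zero, one_mul, neg_add_cancel, map_zero]

/-- Hence `Ψ_l` kills `(𝔭, L₁, …, L_{s+1})`. [folklore] -/
theorem extIdeal_le_ker_genEval : extIdeal 𝒢.𝔭 (𝒢.s + 1) ≤ RingHom.ker (𝒢.genEval l) := by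
  rw [extIdeal, sup_le_iff]
  constructor
  · rw [Ideal.map_le_iff_le_comap]
    intro P hP
    rw [Ideal.mem_comap, RingHom.mem_ker]
    change 𝒢.genEval l (rename Sum.inr P) = 0
    rw [genEval_rename_inr, (NesterenkoK.algebraMap_eq_zero_iff 𝒢.𝔭 P).mpr hP, C_0]
  · rw [Ideal.span_le]
    rintro _ ⟨i, rfl⟩
    rw [SetLike.mem_coe, RingHom.mem_ker]
    refine Fin.lastCases ?_ (fun i => ?_) i
    · exact 𝒢.genEval_linForm_last l
    · exact 𝒢.genEval_linForm_castSucc l i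

/-- `Ψ_l` on `ℚ[U]` is `G ↦ P_l(−x̄_l/x̄ⱼ)`: `specLast` followed by evaluation over `Φⱼ`.
[folklore] -/
theorem genEval_rename_inl (G : RU (𝒢.s + 1) m) :
    𝒢.genEval l (rename Sum.inl G) =
      Polynomial.eval₂ (𝒢.toRUL : RU 𝒢.s m →+* 𝒢.RUL)
        (C (-((𝒢.xb 𝒢.j)⁻¹ * 𝒢.xb (𝒢.j.succAbove l)))) (specLast 𝒢.s 𝒢.j l G) := by
  have h : ((𝒢.genEval l).comp (rename Sum.inl) : RU (𝒢.s + 1) m →ₐ[ℚ] 𝒢.RUL).toRingHom =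
      (Polynomial.eval₂RingHom (𝒢.toRUL : RU 𝒢.s m →+* 𝒢.RUL)
        (C (-((𝒢.xb 𝒢.j)⁻¹ * 𝒢.xb (𝒢.j.succAbove l))))).comp (specLast 𝒢.s 𝒢.j l).toRingHom := by
    refine MvPolynomial.ringHom_ext (fun a => ?_) (fun v => ?_)
    · simp only [AlgHom.toRingHom_eq_coe, RingHom.coe_coe, AlgHom.comp_apply, rename_C,
        RingHom.comp_apply, Polynomial.coe_eval₂RingHom]
      rw [MvPolynomial.algHom_C, MvPolynomial.algHom_C, Polynomial.algebraMap_apply,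
        Polynomial.eval₂_C]
      change _ = 𝒢.toRUL (algebraMap ℚ (RU 𝒢.s m) a)
      rw [AlgHom.commutes]
    · rcases v with ⟨i, k⟩
      simp only [AlgHom.toRingHom_eq_coe, RingHom.coe_coe, AlgHom.comp_apply, rename_X,
        RingHom.comp_apply, Polynomial.coe_eval₂RingHom]
      refine Fin.lastCases ?_ (fun i => ?_) i
      · rw [specLast_X_last, genEval_X_inl, genUVal, Fin.lastCases_last, lastValL]
        refine Fin.succAboveCases 𝒢.j ?_ (fun k => ?_) k
        · rw [lastVal_same, lastVal_same, Polynomial.eval₂_X]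
        · rw [lastVal_succAbove, lastVal_succAbove]
          split_ifs <;> simp
      · rw [specLast_X_castSucc, Polynomial.eval₂_C, genEval_X_inl, genUVal, Fin.lastCases_castSucc]
        change _ = 𝒢.toRUL (X (i, k))
        rw [toRUL_X, NesterenkoK.pivotMap, aeval_X]
  exact RingHom.congr_fun h G

/-- **`P_l(−x̄_l/x̄ⱼ) = 0` in `ℚ(𝔭)[U']`** for `F ∈ Ī(s+1)`: `Ψ_l(F) x̄ⱼ^M = Ψ_l(F x_j^M) = 0` and
`x̄ⱼ ≠ 0`. [cite: NesterenkoPhilippon2001, Ch. 3 Def. 4.3, Prop. 4.11 (pp. 38–41)] -/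
theorem eval₂_specLast_eq_zero {F : RU (𝒢.s + 1) m} (hF : F ∈ elimIdeal 𝒢.𝔭 (𝒢.s + 1)) :
    Polynomial.eval₂ (𝒢.toRUL : RU 𝒢.s m →+* 𝒢.RUL)
      (C (-((𝒢.xb 𝒢.j)⁻¹ * 𝒢.xb (𝒢.j.succAbove l)))) (specLast 𝒢.s 𝒢.j l F) = 0 := by
  obtain ⟨M, -, hM⟩ := hF
  have h := 𝒢.extIdeal_le_ker_genEval l (hM 𝒢.j)
  rw [RingHom.mem_ker, map_mul, map_pow, genEval_X_inr, genEval_rename_inl] at h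
  exact (mul_eq_zero.mp h).resolve_right
    (pow_ne_zero _ ((map_ne_zero_iff _ (C_injective _ _)).mpr 𝒢.xb_j_ne_zero))

/-- The same in `𝕃`: **`−ρ_{j.succAbove l}` is a root of `P_l` over `A = ℚ[U']`**.
[cite: NesterenkoPhilippon2001, Ch. 3 Prop. 4.11 (pp. 40–41)] -/
theorem aeval_specLast_neg_rho {F : RU (𝒢.s + 1) m} (hF : F ∈ elimIdeal 𝒢.𝔭 (𝒢.s + 1)) :
    Polynomial.aeval (-𝒢.rho (𝒢.j.succAbove l)) (specLast 𝒢.s 𝒢.j l F) = 0 := by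
  have hx : -𝒢.rho (𝒢.j.succAbove l) =
      algebraMap 𝒢.RUL 𝒢.LL (C (-((𝒢.xb 𝒢.j)⁻¹ * 𝒢.xb (𝒢.j.succAbove l)))) := by
    rw [rho, map_neg, map_neg, algebraMap_Lp_eq]
  rw [Polynomial.aeval_def, hx,
    show algebraMap (RU 𝒢.s m) 𝒢.LL = (algebraMap 𝒢.RUL 𝒢.LL).comp (𝒢.toRUL : RU 𝒢.s m →+* 𝒢.RUL)
      from rfl, ← Polynomial.hom_eval₂, 𝒢.eval₂_specLast_eq_zero l hF, map_zero]

end Root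

/-! ### Algebraicity of `ρ` and the field `𝕃₀ = K'(ρ)` of the generic section -/

/-- The associated form of `𝔭` in `s + 1` groups lies in `Ī(s+1)`. [folklore] -/
theorem chowForm_mem : chowForm 𝒢.𝔭 (𝒢.s + 1) ∈ elimIdeal 𝒢.𝔭 (𝒢.s + 1) := by
  rw [← span_chowForm 𝒢.𝔭 (𝒢.s + 1)
    (isPrincipal_elimIdeal_of_isPrime 𝒢.prime 𝒢.hom (Nat.succ_pos _) 𝒢.rank)]
  exact Ideal.mem_span_singleton_self _

/-- **Every `ρₖ` is algebraic over `K' = ℚ(U')`** (`ρⱼ = 1`; `−ρ_{j.succAbove l}` is a root of the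
non-zero polynomial `P_l`). [cite: NesterenkoPhilippon2001, Ch. 3 Prop. 4.11 (pp. 40–41)] -/
theorem isAlgebraic_rho (k : Fin (m + 1)) : IsAlgebraic 𝒢.Kp (𝒢.rho k) := by
  refine Fin.succAboveCases 𝒢.j ?_ (fun l => ?_) k
  · rw [rho_j]
    exact isAlgebraic_one
  · set P : Polynomial (RU 𝒢.s m) := specLast 𝒢.s 𝒢.j l (chowForm 𝒢.𝔭 (𝒢.s + 1)) with hP
    have hP0 : P ≠ 0 := specLast_chowForm_ne_zero 𝒢.prime 𝒢.hom 𝒢.rank 𝒢.chart l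
    have hneg : IsAlgebraic 𝒢.Kp (-𝒢.rho (𝒢.j.succAbove l)) := by
      refine ⟨P.map (algebraMap (RU 𝒢.s m) 𝒢.Kp), ?_, ?_⟩
      · exact (Polynomial.map_ne_zero_iff (IsFractionRing.injective (RU 𝒢.s m) 𝒢.Kp)).mpr hP0
      · rw [Polynomial.aeval_map_algebraMap]
        exact 𝒢.aeval_specLast_neg_rho l 𝒢.chowForm_mem
    simpa using hneg.neg

/-- **`𝕃₀ = K'(ρ₀, …, ρ_m)`**, the field of the generic linear section of `V(𝔭)`.
[cite: NesterenkoPhilippon2001, Ch. 3 Prop. 4.11 (pp. 40–41)] -/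
def L0 : IntermediateField 𝒢.Kp 𝒢.LL := IntermediateField.adjoin 𝒢.Kp (Set.range 𝒢.rho)

/-- `ρₖ ∈ 𝕃₀`. [folklore] -/
theorem rho_mem_L0 (k : Fin (m + 1)) : 𝒢.rho k ∈ 𝒢.L0 :=
  IntermediateField.subset_adjoin _ _ ⟨k, rfl⟩

/-- **`𝕃₀ / K'` is a finite extension.** [cite: NesterenkoPhilippon2001, Ch. 3 Prop. 4.11 (pp. 40–41)] -/
instance finiteDimensional_L0 : FiniteDimensional 𝒢.Kp 𝒢.L0 := by
  haveI : Finite (Set.range 𝒢.rho) := (Set.finite_range 𝒢.rho).to_subtype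
  exact IntermediateField.finiteDimensional_adjoin fun x hx => by
    obtain ⟨k, rfl⟩ := hx
    exact (𝒢.isAlgebraic_rho k).isIntegral

/-- `𝕃₀ / K'` is algebraic. [folklore] -/
instance isAlgebraic_L0 : Algebra.IsAlgebraic 𝒢.Kp 𝒢.L0 := Algebra.IsAlgebraic.of_finite _ _

end GSec

end Nesterenko

end Literature.NumberTheory.Transcendental

end
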